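import Summits.NavierStokesRegularity.NavierStokesRegularity.Theorems.TypeICertificateLadderRungReynoldsOneAprioriDecay
import Summits.NavierStokesRegularity.NavierStokesRegularity.Theorems.TypeICertificateLadderRungReynoldsOneRateBookkeeping
import Summits.NavierStokesRegularity.NavierStokesRegularity.Theorems.Target.Negative.ExplicitTypeIConstantSlab

/-!
# Rung `X_1` (crux `RungReynoldsOne`, stmt-2882), line `lp-vorticity-young-budget`: stub S7 (rate bookkeeping), glued

The registered stub `stub_rateBookkeeping` of the lead's skeleton — weighted `L^{5/2}` slab bound (S3)
→ Lamb-form enstrophy slab inequality (S4) → Tao cover (S5) → subcritical enstrophy growth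
`‖u(t)‖₂² + ‖∇u(t)‖₂² ≤ K(T−t)^{-9/20}` along rate-one solutions — obtained by composing the landed
halves `stub_aprioriDecayOf` (a-priori power rates; fed with the sharp `q = 2` enstrophy slab bound
`Target.Negative.lintegral_frobeniusNormSq_le_exp_half_linfty`) and `stub_enstrophyDecayOf`.
[folklore: composition]
-/

noncomputable section

open Set Filter MeasureTheory
open _root_.Topology
open scoped RealInnerProductSpace ENNReal NNReal Laplacian ContDiff
open Literature.Analysis.FluidPDE

namespace Summit.NavierStokesRegularity.NavierStokesRegularity.Theorems.RungReynoldsOne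

-- the problem directory `NavierStokesRegularity/NavierStokesRegularity` forces the duplicated namespace
set_option linter.dupNamespace false

/-- **Stub S7 of the line (registered form): rate bookkeeping** — weighted `L^{5/2}` slab bound →
Lamb-form enstrophy slab inequality → Tao cover → subcritical enstrophy growth
`‖u(t)‖₂² + ‖∇u(t)‖₂² ≤ K(T−t)^{-9/20}` along rate-one solutions; composed from
`stub_aprioriDecayOf` (fed with the sharp `q = 2` slab bound
`Target.Negative.lintegral_frobeniusNormSq_le_exp_half_linfty`) and `stub_enstrophyDecayOf`. -/
theorem stub_rateBookkeeping :
    (∀ ⦃ν T : ℝ⦄, 0 < ν → 0 < T →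
    ∀ ⦃u : ℝ → EuclideanSpace ℝ (Fin 3) → EuclideanSpace ℝ (Fin 3)⦄
      ⦃p : ℝ → EuclideanSpace ℝ (Fin 3) → ℝ⦄,
      IsClassicalNSSolutionOn (Icc 0 T) ν 0 u p →
      HasBoundedSobolevNormsOn (Icc 0 T) u →
      HasBoundedSobolevNormsOn (Icc 0 T) (timeDerivWithin (Icc 0 T) u) →
      (∀ n : ℕ, ∃ C : ℝ≥0, ∀ t ∈ Icc 0 T, ∫⁻ x, ‖iteratedFDeriv ℝ n (p t) x‖ₑ ^ 2 ≤ C) →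
    ∀ ⦃s : ℝ⦄, s ∈ Ioc 0 T →
      (∫⁻ t in Ioo 0 s, ENNReal.ofReal ((eLpNorm (u t) ⊤ volume).toReal ^ (2 : ℝ)) ≠ ⊤) →
      ∫⁻ x, ENNReal.ofReal ((‖curl (u s) x‖ ^ 2 + 1) ^ (5 / 4 : ℝ) - 1) ≤
        ENNReal.ofReal (Real.exp (15 / (16 * ν) *
            (∫⁻ t in Ioo 0 s, ENNReal.ofReal ((eLpNorm (u t) ⊤ volume).toReal ^ (2 : ℝ))).toReal)) *
          ∫⁻ x, ENNReal.ofReal ((‖curl (u 0) x‖ ^ 2 + 1) ^ (5 / 4 : ℝ) - 1)) →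
    (∀ ⦃ν T : ℝ⦄, 0 < ν → 0 < T →
    ∀ ⦃u : ℝ → EuclideanSpace ℝ (Fin 3) → EuclideanSpace ℝ (Fin 3)⦄
      ⦃p : ℝ → EuclideanSpace ℝ (Fin 3) → ℝ⦄,
      IsClassicalNSSolutionOn (Icc 0 T) ν 0 u p →
      HasBoundedSobolevNormsOn (Icc 0 T) u →
      HasBoundedSobolevNormsOn (Icc 0 T) (timeDerivWithin (Icc 0 T) u) →
      (∀ n : ℕ, ∃ C : ℝ≥0, ∀ t ∈ Icc 0 T, ∫⁻ x, ‖iteratedFDeriv ℝ n (p t) x‖ₑ ^ 2 ≤ C) →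
    ∀ ⦃s : ℝ⦄, s ∈ Ioc 0 T →
      ∫⁻ x, ENNReal.ofReal (frobeniusNormSq (fderiv ℝ (u s) x)) ≤
        (∫⁻ x, ENNReal.ofReal (frobeniusNormSq (fderiv ℝ (u 0) x))) +
          ENNReal.ofReal ((2 * ν)⁻¹) *
            ∫⁻ t in Ioo 0 s, (∫⁻ x, ‖u t x‖ₑ ^ (10 : ℝ)) ^ (1 / 5 : ℝ) *
              (∫⁻ x, ‖curl (u t) x‖ₑ ^ (5 / 2 : ℝ)) ^ (4 / 5 : ℝ)) →
    (∀ ⦃ν T : ℝ⦄, 0 < ν → 0 < T →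
    ∀ ⦃u : ℝ → EuclideanSpace ℝ (Fin 3) → EuclideanSpace ℝ (Fin 3)⦄
      ⦃p : ℝ → EuclideanSpace ℝ (Fin 3) → ℝ⦄,
      IsClassicalNSSolutionOn (Ico 0 T) ν 0 u p → IsLerayHopfOn T ν 0 (u 0) u →
      HasRapidSpatialDecay (u 0) →
    ∀ ⦃T' : ℝ⦄, T' ∈ Ioo 0 T →
      ∃ q : ℝ → EuclideanSpace ℝ (Fin 3) → ℝ,
        IsClassicalNSSolutionOn (Icc 0 T') ν 0 u q ∧
        HasBoundedSobolevNormsOn (Icc 0 T') u ∧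
        HasBoundedSobolevNormsOn (Icc 0 T') (timeDerivWithin (Icc 0 T') u) ∧
        (∀ n : ℕ, ∃ C : ℝ≥0, ∀ t ∈ Icc 0 T', ∫⁻ x, ‖iteratedFDeriv ℝ n (q t) x‖ₑ ^ 2 ≤ C)) →
    ∀ ⦃ν T : ℝ⦄, 0 < ν → 0 < T →
    ∀ ⦃u : ℝ → EuclideanSpace ℝ (Fin 3) → EuclideanSpace ℝ (Fin 3)⦄
      ⦃p : ℝ → EuclideanSpace ℝ (Fin 3) → ℝ⦄,
      IsClassicalNSSolutionOn (Ico 0 T) ν 0 u p → IsLerayHopfOn T ν 0 (u 0) u →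
      HasRapidSpatialDecay (u 0) →
      (∀ᶠ t in 𝓝[<] T, ∀ x, Real.sqrt (T - t) * ‖u t x‖ ≤ Real.sqrt ν) →
      ∃ K : ℝ, ∃ t₀ ∈ Ico 0 T, ∀ t ∈ Ico t₀ T,
        (∫⁻ x, ‖u t x‖ₑ ^ 2) + ∫⁻ x, ENNReal.ofReal (frobeniusNormSq (fderiv ℝ (u t) x)) ≤
          ENNReal.ofReal (K * (T - t) ^ (-(9 / 20 : ℝ))) :=
  fun hA hL hC => stub_enstrophyDecayOf
    (stub_aprioriDecayOf
      (fun _ν _T hν hT _u _p hsol hu hut hp _s hs hfin =>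
        Target.Negative.lintegral_frobeniusNormSq_le_exp_half_linfty hν hT hsol hu hut hp hs hfin)
      hA hC) hL hC


end Summit.NavierStokesRegularity.NavierStokesRegularity.Theorems.RungReynoldsOne

end
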